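import Literature.Analysis.Calculus.IteratedFDerivSymmetric   -- ★ all-orders symmetry `iteratedFDeriv_apply_perm_of_le` (Schwarz–Clairaut for `C^n` maps)
import HarnessLib

/-!
# Nested Fréchet derivatives up to order four: the dictionary with `iteratedFDeriv` and the slot symmetries
# (Dieudonné, *Foundations of Modern Analysis*, (8.12.4); Hörmander ALPDO I, Thm. 1.1.8)

Topic `Analysis/Calculus`; namespace `Literature.Analysis.Calculus`.  THEOREMS ONLY (no `def`, no instance, no notation, no axiom, no named fact, no `sorry`).
Generic support file (real normed spaces); written for the (A4-iii) assembly of crux H413 (cell `pub/hodgecm-mathlib`, blueprint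
`F0/P3a/F0P3a-p06/g12/BLUEPRINT-A4iii-ValueIdentity.F0P3a-p06g12.md`, package W1′), where the jets of a test function arrive in NESTED form
`fderiv ℝ (fderiv ℝ (fderiv ℝ Θ)) x a b c` (the chain rules of ★ `UnitBallKCentralWallCurveChain` and of the χ-datum) while the symmetry of higher
derivatives is available in the tree for `iteratedFDeriv` (★ `IteratedFDerivSymmetric`); author F0P3a-p06 (g12), 2026-09-01.

* §1 evaluation under `fderiv`: `fderiv (fun y => G y b) x = (fderiv G x).flip b` for CLM-valued `G`, and its applied forms;
* §2 THE DICTIONARY: `iteratedFDeriv ℝ 3 f x ![a, b, c] = fderiv (fderiv (fderiv f)) x a b c` (`f ∈ C³`) and the order-four analogue (`f ∈ C⁴`)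
  (order two is Mathlib's `iteratedFDeriv_two_apply`);
* §3 SLOT SYMMETRIES of the nested forms: all adjacent transpositions at orders 2, 3, 4 (`nestedFDeriv_two_swap`, `nestedFDeriv_three_swap01∕12`, `nestedFDeriv_four_swap01∕12∕23`),
  i.e. the nested third and fourth derivatives of a `C³`∕`C⁴` map are symmetric in all slots — exactly the hypotheses `hL3sw*`, `hL4sw*` of the generated
  identity files ★ `UnitBallCentreValueIdentityOrder*`.
HONEST LABEL: calculus plumbing; pays nothing by itself (HC_CM is proved only modulo the printed citations until rung 0 closes).

## References
* [Dieudonne1960] J. Dieudonné, *Foundations of Modern Analysis* (1960), Ch. VIII §12, (8.12.4) (symmetry of higher derivatives).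
* [HormanderALPDO1] L. Hörmander, *The Analysis of Linear Partial Differential Operators I*, 2nd ed. (1990), Thm. 1.1.8.
-/

noncomputable section

open Function

namespace Literature.Analysis.Calculus

variable {E F H : Type*} [NormedAddCommGroup E] [NormedSpace ℝ E] [NormedAddCommGroup F] [NormedSpace ℝ F]
  [NormedAddCommGroup H] [NormedSpace ℝ H]

/-! ### §1 Evaluation at a constant argument commutes with `fderiv` -/

/-- For a differentiable CLM-valued map `G` and a constant argument `b`: `fderiv (y ↦ G y b) x = (fderiv G x).flip b`. [cite: Dieudonne1960, Ch. VIII §12] -/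
theorem nestedFDeriv_eval_const_eq_flip {G : E → F →L[ℝ] H} {x : E} (hG : DifferentiableAt ℝ G x) (b : F) :
    fderiv ℝ (fun y => G y b) x = (fderiv ℝ G x).flip b := by
  rw [fderiv_clm_apply hG (differentiableAt_const b)]
  simp

/-- Applied form: `fderiv (y ↦ G y b) x a = fderiv G x a b`. [cite: Dieudonne1960, Ch. VIII §12] -/
theorem nestedFDeriv_eval_const_apply {G : E → F →L[ℝ] H} {x : E} (hG : DifferentiableAt ℝ G x) (a : E) (b : F) :
    fderiv ℝ (fun y => G y b) x a = fderiv ℝ G x a b := by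
  rw [nestedFDeriv_eval_const_eq_flip hG b, ContinuousLinearMap.flip_apply]

/-- `y ↦ G y b` is differentiable where `G` is. [cite: Dieudonne1960, Ch. VIII §12] -/
theorem differentiableAt_eval_const_nested {G : E → F →L[ℝ] H} {x : E} (hG : DifferentiableAt ℝ G x) (b : F) :
    DifferentiableAt ℝ (fun y => G y b) x :=
  hG.clm_apply (differentiableAt_const b)

/-- Two constant arguments: `fderiv (y ↦ G y b c) x a = fderiv G x a b c` for `G : E → (F →L F' →L H)`. [cite: Dieudonne1960, Ch. VIII §12] -/
theorem nestedFDeriv_eval_const_const_apply {F' : Type*} [NormedAddCommGroup F'] [NormedSpace ℝ F'] {G : E → F →L[ℝ] F' →L[ℝ] H} {x : E}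
    (hG : DifferentiableAt ℝ G x) (a : E) (b : F) (c : F') :
    fderiv ℝ (fun y => G y b c) x a = fderiv ℝ G x a b c := by
  have h1 : DifferentiableAt ℝ (fun y => G y b) x := differentiableAt_eval_const_nested hG b
  rw [show (fun y => G y b c) = fun y => (fun y' => G y' b) y c from rfl, nestedFDeriv_eval_const_apply h1 a c,
    nestedFDeriv_eval_const_apply hG a b]

/-! ### §2 The dictionary nested ↔ `iteratedFDeriv` at orders three and four -/

/-- `tail ![a, b, c] = ![b, c]` and friends are `simp`-facts; we record the two evaluations used below. [folklore] -/
private theorem vec3_zero_tail {α : Type*} (a b c : α) : (![a, b, c] : Fin 3 → α) 0 = a ∧ Fin.tail (![a, b, c] : Fin 3 → α) = ![b, c] := by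
  refine ⟨rfl, ?_⟩
  funext i
  fin_cases i <;> rfl

/-- Same at length four. [folklore] -/
private theorem vec4_zero_tail {α : Type*} (a b c d : α) : (![a, b, c, d] : Fin 4 → α) 0 = a ∧ Fin.tail (![a, b, c, d] : Fin 4 → α) = ![b, c, d] := by
  refine ⟨rfl, ?_⟩
  funext i
  fin_cases i <;> rfl

/-- **ORDER THREE**: `D³f(x)[a, b, c] = fderiv (fderiv (fderiv f)) x a b c` for `f ∈ C³` (outermost slot = first argument). [cite: Dieudonne1960, Ch. VIII §12 (8.12.4)] -/
theorem iteratedFDeriv_three_eq_nestedFDeriv {f : E → F} (hf : ContDiff ℝ 3 f) (x a b c : E) :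
    iteratedFDeriv ℝ 3 f x ![a, b, c] = fderiv ℝ (fderiv ℝ (fderiv ℝ f)) x a b c := by
  have hd : DifferentiableAt ℝ (iteratedFDeriv ℝ 2 f) x :=
    hf.contDiffAt.differentiableAt_iteratedFDeriv (by exact_mod_cast Nat.lt_succ_self 2)
  have h2 : ContDiff ℝ 1 (fderiv ℝ (fderiv ℝ f)) := (hf.fderiv_right (m := 2) (by norm_cast)).fderiv_right (m := 1) (by norm_cast)
  have hG : DifferentiableAt ℝ (fderiv ℝ (fderiv ℝ f)) x := h2.differentiable one_ne_zero x
  rw [hd.iteratedFDeriv_succ_apply_left', (vec3_zero_tail a b c).2]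
  have hfun : (fun y => iteratedFDeriv ℝ 2 f y ![b, c]) = fun y => fderiv ℝ (fderiv ℝ f) y b c := by
    funext y
    rw [iteratedFDeriv_two_apply]
    rfl
  rw [hfun, show (![a, b, c] : Fin 3 → E) 0 = a from rfl, nestedFDeriv_eval_const_const_apply hG a b c]

/-- **ORDER FOUR**: `D⁴f(x)[a, b, c, d] = fderiv (fderiv (fderiv (fderiv f))) x a b c d` for `f ∈ C⁴`. [cite: Dieudonne1960, Ch. VIII §12 (8.12.4)] -/
theorem iteratedFDeriv_four_eq_nestedFDeriv {f : E → F} (hf : ContDiff ℝ 4 f) (x a b c d : E) :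
    iteratedFDeriv ℝ 4 f x ![a, b, c, d] = fderiv ℝ (fderiv ℝ (fderiv ℝ (fderiv ℝ f))) x a b c d := by
  -- the operator-norm instances of the triply nested CLM space are not found by instance search unaided (depth); supply the chain
  letI i2 : NormedAddCommGroup (E →L[ℝ] E →L[ℝ] F) := inferInstance
  letI : NormedSpace ℝ (E →L[ℝ] E →L[ℝ] F) := inferInstance
  letI i3 : NormedAddCommGroup (E →L[ℝ] E →L[ℝ] E →L[ℝ] F) := inferInstance
  letI : NormedSpace ℝ (E →L[ℝ] E →L[ℝ] E →L[ℝ] F) := inferInstance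
  have hd : DifferentiableAt ℝ (iteratedFDeriv ℝ 3 f) x :=
    hf.contDiffAt.differentiableAt_iteratedFDeriv (by exact_mod_cast Nat.lt_succ_self 3)
  have h3 : ContDiff ℝ 3 f := hf.of_le (by norm_cast)
  have hG5 : ContDiff ℝ 3 (fderiv ℝ f) := hf.fderiv_right (m := 3) (by norm_cast)
  have hG4 : ContDiff ℝ 2 (fderiv ℝ (fderiv ℝ f)) := hG5.fderiv_right (m := 2) (by norm_cast)
  have hG3 : ContDiff ℝ 1 (fderiv ℝ (fderiv ℝ (fderiv ℝ f))) := hG4.fderiv_right (m := 1) (by norm_cast)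
  have hG : DifferentiableAt ℝ (fderiv ℝ (fderiv ℝ (fderiv ℝ f))) x := hG3.differentiable one_ne_zero x
  rw [hd.iteratedFDeriv_succ_apply_left', (vec4_zero_tail a b c d).2]
  have hfun : (fun y => iteratedFDeriv ℝ 3 f y ![b, c, d]) = fun y => fderiv ℝ (fderiv ℝ (fderiv ℝ f)) y b c d := by
    funext y
    exact iteratedFDeriv_three_eq_nestedFDeriv h3 y b c d
  have h1 : DifferentiableAt ℝ (fun y => fderiv ℝ (fderiv ℝ (fderiv ℝ f)) y b) x :=
    differentiableAt_eval_const_nested (G := fderiv ℝ (fderiv ℝ (fderiv ℝ f))) hG b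
  rw [hfun, show (![a, b, c, d] : Fin 4 → E) 0 = a from rfl,
    show (fun y => fderiv ℝ (fderiv ℝ (fderiv ℝ f)) y b c d) = fun y => (fun y' => fderiv ℝ (fderiv ℝ (fderiv ℝ f)) y' b) y c d from rfl,
    nestedFDeriv_eval_const_const_apply h1 a c d, nestedFDeriv_eval_const_apply hG a b]

/-! ### §3 Slot symmetries of the nested derivatives (orders two, three, four) -/

/-- Order two (Mathlib's `IsSymmSndFDerivAt`, restated for `C²` maps): `D²f(x)[u][v] = D²f(x)[v][u]`. [cite: Dieudonne1960, Ch. VIII §12 (8.12.4)] -/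
theorem nestedFDeriv_two_swap {f : E → F} (hf : ContDiff ℝ 2 f) (x u v : E) :
    fderiv ℝ (fderiv ℝ f) x u v = fderiv ℝ (fderiv ℝ f) x v u :=
  (hf.contDiffAt.isSymmSndFDerivAt (by simp)).eq u v

/-- Order three, outer pair: `D³f(x)[a][b][c] = D³f(x)[b][a][c]`. [cite: Dieudonne1960, Ch. VIII §12 (8.12.4)] -/
theorem nestedFDeriv_three_swap01 {f : E → F} (hf : ContDiff ℝ 3 f) (x a b c : E) :
    fderiv ℝ (fderiv ℝ (fderiv ℝ f)) x a b c = fderiv ℝ (fderiv ℝ (fderiv ℝ f)) x b a c := by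
  rw [← iteratedFDeriv_three_eq_nestedFDeriv hf, ← iteratedFDeriv_three_eq_nestedFDeriv hf]
  have h := iteratedFDeriv_apply_perm_of_le (𝕜 := ℝ) (hf.contDiffAt (x := x)) (m := 3) le_rfl ![a, b, c] (Equiv.swap 0 1)
  have hv : (fun i => (![a, b, c] : Fin 3 → E) ((Equiv.swap 0 1) i)) = ![b, a, c] := by
    funext i; fin_cases i <;> rfl
  rw [hv] at h
  exact h.symm

/-- Order three, inner pair: `D³f(x)[a][b][c] = D³f(x)[a][c][b]`. [cite: Dieudonne1960, Ch. VIII §12 (8.12.4)] -/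
theorem nestedFDeriv_three_swap12 {f : E → F} (hf : ContDiff ℝ 3 f) (x a b c : E) :
    fderiv ℝ (fderiv ℝ (fderiv ℝ f)) x a b c = fderiv ℝ (fderiv ℝ (fderiv ℝ f)) x a c b := by
  rw [← iteratedFDeriv_three_eq_nestedFDeriv hf, ← iteratedFDeriv_three_eq_nestedFDeriv hf]
  have h := iteratedFDeriv_apply_perm_of_le (𝕜 := ℝ) (hf.contDiffAt (x := x)) (m := 3) le_rfl ![a, b, c] (Equiv.swap 1 2)
  have hv : (fun i => (![a, b, c] : Fin 3 → E) ((Equiv.swap 1 2) i)) = ![a, c, b] := by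
    funext i; fin_cases i <;> rfl
  rw [hv] at h
  exact h.symm

/-- Order four, slots 0–1: `D⁴f(x)[a][b][c][d] = D⁴f(x)[b][a][c][d]`. [cite: Dieudonne1960, Ch. VIII §12 (8.12.4)] -/
theorem nestedFDeriv_four_swap01 {f : E → F} (hf : ContDiff ℝ 4 f) (x a b c d : E) :
    fderiv ℝ (fderiv ℝ (fderiv ℝ (fderiv ℝ f))) x a b c d = fderiv ℝ (fderiv ℝ (fderiv ℝ (fderiv ℝ f))) x b a c d := by
  -- the operator-norm instances of the triply nested CLM space are not found by instance search unaided (depth); supply the chain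
  letI i2 : NormedAddCommGroup (E →L[ℝ] E →L[ℝ] F) := inferInstance
  letI : NormedSpace ℝ (E →L[ℝ] E →L[ℝ] F) := inferInstance
  letI i3 : NormedAddCommGroup (E →L[ℝ] E →L[ℝ] E →L[ℝ] F) := inferInstance
  letI : NormedSpace ℝ (E →L[ℝ] E →L[ℝ] E →L[ℝ] F) := inferInstance
  rw [← iteratedFDeriv_four_eq_nestedFDeriv hf, ← iteratedFDeriv_four_eq_nestedFDeriv hf]
  have h := iteratedFDeriv_apply_perm_of_le (𝕜 := ℝ) (hf.contDiffAt (x := x)) (m := 4) le_rfl ![a, b, c, d] (Equiv.swap 0 1)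
  have hv : (fun i => (![a, b, c, d] : Fin 4 → E) ((Equiv.swap 0 1) i)) = ![b, a, c, d] := by
    funext i; fin_cases i <;> rfl
  rw [hv] at h
  exact h.symm

/-- Order four, slots 1–2: `D⁴f(x)[a][b][c][d] = D⁴f(x)[a][c][b][d]`. [cite: Dieudonne1960, Ch. VIII §12 (8.12.4)] -/
theorem nestedFDeriv_four_swap12 {f : E → F} (hf : ContDiff ℝ 4 f) (x a b c d : E) :
    fderiv ℝ (fderiv ℝ (fderiv ℝ (fderiv ℝ f))) x a b c d = fderiv ℝ (fderiv ℝ (fderiv ℝ (fderiv ℝ f))) x a c b d := by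
  -- the operator-norm instances of the triply nested CLM space are not found by instance search unaided (depth); supply the chain
  letI i2 : NormedAddCommGroup (E →L[ℝ] E →L[ℝ] F) := inferInstance
  letI : NormedSpace ℝ (E →L[ℝ] E →L[ℝ] F) := inferInstance
  letI i3 : NormedAddCommGroup (E →L[ℝ] E →L[ℝ] E →L[ℝ] F) := inferInstance
  letI : NormedSpace ℝ (E →L[ℝ] E →L[ℝ] E →L[ℝ] F) := inferInstance
  rw [← iteratedFDeriv_four_eq_nestedFDeriv hf, ← iteratedFDeriv_four_eq_nestedFDeriv hf]
  have h := iteratedFDeriv_apply_perm_of_le (𝕜 := ℝ) (hf.contDiffAt (x := x)) (m := 4) le_rfl ![a, b, c, d] (Equiv.swap 1 2)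
  have hv : (fun i => (![a, b, c, d] : Fin 4 → E) ((Equiv.swap 1 2) i)) = ![a, c, b, d] := by
    funext i; fin_cases i <;> rfl
  rw [hv] at h
  exact h.symm

/-- Order four, slots 2–3: `D⁴f(x)[a][b][c][d] = D⁴f(x)[a][b][d][c]`. [cite: Dieudonne1960, Ch. VIII §12 (8.12.4)] -/
theorem nestedFDeriv_four_swap23 {f : E → F} (hf : ContDiff ℝ 4 f) (x a b c d : E) :
    fderiv ℝ (fderiv ℝ (fderiv ℝ (fderiv ℝ f))) x a b c d = fderiv ℝ (fderiv ℝ (fderiv ℝ (fderiv ℝ f))) x a b d c := by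
  -- the operator-norm instances of the triply nested CLM space are not found by instance search unaided (depth); supply the chain
  letI i2 : NormedAddCommGroup (E →L[ℝ] E →L[ℝ] F) := inferInstance
  letI : NormedSpace ℝ (E →L[ℝ] E →L[ℝ] F) := inferInstance
  letI i3 : NormedAddCommGroup (E →L[ℝ] E →L[ℝ] E →L[ℝ] F) := inferInstance
  letI : NormedSpace ℝ (E →L[ℝ] E →L[ℝ] E →L[ℝ] F) := inferInstance
  rw [← iteratedFDeriv_four_eq_nestedFDeriv hf, ← iteratedFDeriv_four_eq_nestedFDeriv hf]
  have h := iteratedFDeriv_apply_perm_of_le (𝕜 := ℝ) (hf.contDiffAt (x := x)) (m := 4) le_rfl ![a, b, c, d] (Equiv.swap 2 3)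
  have hv : (fun i => (![a, b, c, d] : Fin 4 → E) ((Equiv.swap 2 3) i)) = ![a, b, d, c] := by
    funext i; fin_cases i <;> rfl
  rw [hv] at h
  exact h.symm

end Literature.Analysis.Calculus

end
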